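import Summits.CriticalPhenomena.Ising3D.Control2DL11GapACells
import Summits.CriticalPhenomena.Ising3D.Control2DL11GapATable2
import Mathlib.Tactic.Linarith
import Mathlib.Tactic.NormNum
import HarnessLib

/-!
# A Λ = 11 kind-`gap` 2D γ-certificate in the kernel: `Δ_ε < 5003/5000` at `Δ_σ = 1/8`
(cell `pub-ising3x`, seat controls-1 gen 16; KERNEL PATH for the 2D γ-certificates, Λ = 11 — CONTROL-ONLY)

HONEST FRAMING: lottery ticket; floor = tightest certified 3D Ising CFT bounds; no exact-solution
claim without a proof. CONTROL-ONLY: `d = 2`, global blocks, `Δ_σ = 1/8` exact, unitarity only; validates the certificate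
PIPELINE on the exactly solved 2D Ising model (`Δ_ε = 1`), nothing about `d = 3`.

**`gapExcluded_2d_L11_gapA : GapExcluded (1/8) (5003 / 5000)`** from the RB-1 certificate `j106899_functional_deriv2d_L11_E032_eps1.0006.json` (Λ = 11, E₀ = 32): Δ_ε < 5003/5000 at Δ_σ = 1/8, every obligation ((I) `ident_gapA`,
(R) `region_gapA`, cells `cells_gapA`) re-decided in the Lean kernel. Zero grant compute. No facts, standard axioms only.
-/

namespace Summit.CriticalPhenomena.Ising3D.Control2D

open Finset Set
open Literature.MathematicalPhysics.QuantumFieldTheory.ConformalBootstrap3D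

/-- **2D control, γ-architecture, Λ = 11, kernel-complete: `Δ_ε < 5003/5000` at `Δ_σ = 1/8`.** CONTROL-ONLY (d = 2).
[cite: RattazziEtAl2008, §5.5] -/
theorem gapExcluded_2d_L11_gapA : GapExcluded (1 / 8 : ℝ) (5003 / 5000) :=
  gapExcluded_half_of_cellsN slL11.toFinset (fun p => (wtgapA p : ℝ)) (by norm_num) (by norm_num) (by norm_num)
    ident_gapA (fun b J hb hE => region_gapA b J hb hE) cells_gapA

end Summit.CriticalPhenomena.Ising3D.Control2D
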